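import Summits.ABC.IUTFork.Repair.RHTieDeciderSqrtNegOne
import Summits.ABC.IUTFork.Repair.RHReachLedgerQ2GenuineTiesUnit
import HarnessLib

/-!
# D-0079 RESCUE sub-cell R-H, TIE-DECIDER lane — row 27 Q2 twins with (O″) owed ONLY at the bad primes `p ≢ 3 (mod 4)`:
# `LedgerAtDatum T ⟹ T.Cor312NonarchOf` and `K2Target27`, the clause at `p ≡ 3 (mod 4)` discharged by `√−1 ∈ K`

PROOF-ONLY file (0 definitions, 0 `Prop` facts; abc-iut cell, D-0079 RESCUE sub-cell R-H, rung LADDER-ABC:A2.RESCUE.H; seat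
abc-iut-rh-typ-12 gen 5, TIE-DECIDER lane). TAKES NO SIDE on [IUTchIII] Cor. 3.12 or on any author; typed ≠ proved; instantiated ≠
endorsed; nothing here asserts abc proved or refuted. Row 27's ledger (`HStarReachLedgerK` p464022 / `LedgerAtDatum` p468994) is an R-H
CANDIDATE = a HYPOTHESIS SHAPE.

Sequel of `Repair/RHTieDeciderSqrtNegOne.lean` (this seat: at a genuine datum `√−1 ∈ K`, so every place over a prime `p ≡ 3 (mod 4)` has
residue degree `≥ 2` — `InitialThetaData.outerUnit_clause_of_mod_four_eq_three`) over abc-iut-rh2-L1's `Repair/RHReachLedgerQ2GenuineTiesUnit.lean`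
(`cor312NonarchOf_of_ledgerAtDatum_outerUnit(_of_isGalois)`, `k2Target27_of_outerUnit`, `k2Target27_of_isGalois_outerUnit`). PROVED, each
the cited theorem VERBATIM except that (O″) «`e(𝔭_w∣p) ≠ p^a(p−1)` for all `a`, or per place `x ∣ p`: `f(𝔭_x∣p) ≥ 2` or some `π ∈ K_x`
with `‖π‖ = p^{−1/e}` and `‖1 + π^e/p‖ = 1`» is asked ONLY at the bad primes `p` with `p % 4 ≠ 3`:
* `ThetaVolumeDatumAt.two_le_inertiaDeg_placeOf_of_mod_four_eq_three` — at a genuine Θ-volume datum `T`, every place of `K = T.K` over a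
  prime `p ≡ 3 (mod 4)` has `f ≥ 2` (restatement of §2 of the prequel at `T.D`).
* `cor312NonarchOf_of_ledgerAtDatum_outerUnit_modFour`, `cor312NonarchOf_of_ledgerAtDatum_outerUnit_of_isGalois_modFour`;
* **`k2Target27_of_outerUnit_modFour`**, **`k2Target27_of_isGalois_outerUnit_modFour`**.
So the kernel-exact residual of row 27's certificate binder on Σ₂₇ data is: a bad prime `p ≡ 1 (mod 4)` of cyclotomic index
`e_p = p^a(p−1)` carrying a residue-degree-`1` place of cyclotomic type. On abc-iut-rh2-q3-num's 258-datum Q3 universe (Q3-TIE27-v1.tsv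
30af8025d2a3c782) the only candidate tied triple was λ₇ @ `l = 41`, `p = 1231 ≡ 3 (mod 4)` — decided by the prequel; this (U)/(O″)-residual
is EMPTY on that table (a table fact about which primes are bad and tied, not a kernel statement).
[cite: NeukirchANT1999, Ch. I §8, §9 (9.1), Ch. II (5.5)–(5.7)] [cite: IrelandRosen1990, Ch. 7 §1 Thm. 1, Ch. 5 §1 Prop. 5.1.2]
[cite: DupuyHilado2025, §1 (1.1), §3.4, §3.9, §4.9] [cite: Mochizuki2012, IUTchI Def. 3.1 (a),(b) p. 61, Ex. 3.2 (iv) p. 71; IUTchIII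
Cor. 3.12 p. 173–174] [claim: Mochizuki2012, status: disputed]
-/

noncomputable section

open Set Function NumberField IsDedekindDomain

namespace Summit.ABC.IUTFork.Repair.RH.TieDecider

open Thm311 Thm311.Real Cor312 Cor312Vol Cor312Prov Literature.IUT.LogThetaLattice Literature.IUT.LogVolume
  Literature.IUT.HodgeTheaters Literature.IUT.LogVolume.ThetaData Summit.ABC.IUTFork.Repair.RH.ReachLedger
  Summit.ABC.IUTFork.Repair.RH.ReachLedgerDoor Summit.ABC.IUTFork.Repair.RH.ReachLedgerQ2
open Literature.NumberTheory.DiophantineGeometry Literature.NumberTheory.DiophantineGeometry.GenEll Summit.ABC.ABC.Theorems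
  Summit.ABC.IUTFork.Conditional
open scoped Classical

/-! ## §0. At a genuine Θ-volume datum: `f ≥ 2` over every `p ≡ 3 (mod 4)` -/

section Datum

/-- **At a genuine Θ-volume datum `T` (`X := pilotDataOfK T.D T.K`) every fibre point over a prime `p ≡ 3 (mod 4)` has `f(𝔭_x∣p) ≥ 2`**
(`√−1 ∈ F ⊆ K`, [IUTchI] Def. 3.1 (a)). [cite: Mochizuki2012, IUTchI Def. 3.1 (a) p. 61] [cite: IrelandRosen1990, Ch. 5 §1 Prop. 5.1.2]
[claim: Mochizuki2012, status: disputed] -/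
theorem _root_.Literature.IUT.LogVolume.Cor22.ThetaVolumeDatumAt.two_le_inertiaDeg_placeOf_of_mod_four_eq_three {P : NFPoint} {l : ℕ}
    (T : Cor22.ThetaVolumeDatumAt P l) (pp : Nat.Primes) (hp4 : (pp : ℕ) % 4 = 3) :
    letI := T.instFieldF; letI := T.instNumberFieldF; letI := T.instAlgebraF; letI := T.instFieldK; letI := T.instNumberFieldK;
    letI := T.instAlgebraK; letI := T.instFieldFbar; letI := T.instAlgebraFbar; letI := T.instAlgebraKFbar; letI := T.instIsElliptic
    haveI : Fact (pp : ℕ).Prime := ⟨pp.2⟩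
    ∀ x : (thetaIndex (pilotDataOfK T.D T.K)).Fibre (.inr pp),
      2 ∣ (placeOf (pilotDataOfK T.D T.K) pp.1 x).asIdeal.inertiaDeg ℤ ∧ 2 ≤ (placeOf (pilotDataOfK T.D T.K) pp.1 x).asIdeal.inertiaDeg ℤ := by
  letI := T.instFieldF; letI := T.instNumberFieldF; letI := T.instAlgebraF; letI := T.instFieldK; letI := T.instNumberFieldK
  letI := T.instAlgebraK; letI := T.instFieldFbar; letI := T.instAlgebraFbar; letI := T.instAlgebraKFbar; letI := T.instIsElliptic
  intro x
  exact ⟨T.D.two_dvd_inertiaDeg_placeOf_of_mod_four_eq_three pp hp4 x, T.D.two_le_inertiaDeg_placeOf_of_mod_four_eq_three pp hp4 x⟩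

end Datum

/-! ## §1. The Q2(27) arrows with (O″) owed only off `p ≡ 3 (mod 4)` -/

section KFamily

variable
    (M : ∀ (P : NFPoint) (l : ℕ) (T : Cor22.ThetaVolumeDatumAt P l), Type) [∀ P l T, Field (M P l T)] [∀ P l T, NumberField (M P l T)]
    (archPk : ∀ (P : NFPoint) (l : ℕ) (T : Cor22.ThetaVolumeDatumAt P l), letI := T.instFieldF; letI := T.instNumberFieldF; letI := T.instAlgebraF; letI := T.instFieldK;
        letI := T.instNumberFieldK; letI := T.instAlgebraK; letI := T.instFieldFbar; letI := T.instAlgebraFbar;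
        letI := T.instAlgebraKFbar; letI := T.instIsElliptic;
      ∀ (j : (thetaIndex (pilotDataOfK T.D T.K)).Label) (vQ : (thetaIndex (pilotDataOfK T.D T.K)).VQ), Set ((logShellsDH (pilotDataOfK T.D T.K) (analyticLogv T.K)).Packet j vQ))
    (archSub : ∀ (P : NFPoint) (l : ℕ) (T : Cor22.ThetaVolumeDatumAt P l), letI := T.instFieldF; letI := T.instNumberFieldF; letI := T.instAlgebraF; letI := T.instFieldK;
        letI := T.instNumberFieldK; letI := T.instAlgebraK; letI := T.instFieldFbar; letI := T.instAlgebraFbar;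
        letI := T.instAlgebraKFbar; letI := T.instIsElliptic;
      ∀ (j : (thetaIndex (pilotDataOfK T.D T.K)).Label) (v : (thetaIndex (pilotDataOfK T.D T.K)).V), Set ((logShellsDH (pilotDataOfK T.D T.K) (analyticLogv T.K)).Packet j ((thetaIndex (pilotDataOfK T.D T.K)).over v)))
    (Ψ : ∀ (P : NFPoint) (l : ℕ) (T : Cor22.ThetaVolumeDatumAt P l), letI := T.instFieldF; letI := T.instNumberFieldF; letI := T.instAlgebraF; letI := T.instFieldK;
        letI := T.instNumberFieldK; letI := T.instAlgebraK; letI := T.instFieldFbar; letI := T.instAlgebraFbar;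
        letI := T.instAlgebraKFbar; letI := T.instIsElliptic;
      ℤ → ∀ v : (thetaIndex (pilotDataOfK T.D T.K)).V, v ∈ (thetaIndex (pilotDataOfK T.D T.K)).Vbad → Set ((logShellsDH (pilotDataOfK T.D T.K) (analyticLogv T.K)).StarPacket v))
    (act : ∀ (P : NFPoint) (l : ℕ) (T : Cor22.ThetaVolumeDatumAt P l), letI := T.instFieldF; letI := T.instNumberFieldF; letI := T.instAlgebraF; letI := T.instFieldK;
        letI := T.instNumberFieldK; letI := T.instAlgebraK; letI := T.instFieldFbar; letI := T.instAlgebraFbar;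
        letI := T.instAlgebraKFbar; letI := T.instIsElliptic;
      ℤ → ∀ v : (thetaIndex (pilotDataOfK T.D T.K)).V, v ∈ (thetaIndex (pilotDataOfK T.D T.K)).Vbad → (logShellsDH (pilotDataOfK T.D T.K) (analyticLogv T.K)).StarPacket v → Module.End ℚ ((logShellsDH (pilotDataOfK T.D T.K) (analyticLogv T.K)).StarPacket v))
    (Mmod : ∀ (P : NFPoint) (l : ℕ) (T : Cor22.ThetaVolumeDatumAt P l), letI := T.instFieldF; letI := T.instNumberFieldF; letI := T.instAlgebraF; letI := T.instFieldK;
        letI := T.instNumberFieldK; letI := T.instAlgebraK; letI := T.instFieldFbar; letI := T.instAlgebraFbar;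
        letI := T.instAlgebraKFbar; letI := T.instIsElliptic;
      ℤ → ∀ j : (thetaIndex (pilotDataOfK T.D T.K)).LabelStar, Set ((logShellsDH (pilotDataOfK T.D T.K) (analyticLogv T.K)).GlobalPacket j.1))
    (region : ∀ (P : NFPoint) (l : ℕ) (T : Cor22.ThetaVolumeDatumAt P l), letI := T.instFieldF; letI := T.instNumberFieldF; letI := T.instAlgebraF; letI := T.instFieldK;
        letI := T.instNumberFieldK; letI := T.instAlgebraK; letI := T.instFieldFbar; letI := T.instAlgebraFbar;
        letI := T.instAlgebraKFbar; letI := T.instIsElliptic;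
      ℤ → ∀ j : (thetaIndex (pilotDataOfK T.D T.K)).LabelStar, FinDivisor (M P l T) → ∀ vQ : (thetaIndex (pilotDataOfK T.D T.K)).VQ, Set ((logShellsDH (pilotDataOfK T.D T.K) (analyticLogv T.K)).Packet j.1 vQ))
    (n : ∀ (P : NFPoint) (l : ℕ) (T : Cor22.ThetaVolumeDatumAt P l), ℤ)
    {HT : ∀ (P : NFPoint) (l : ℕ) (T : Cor22.ThetaVolumeDatumAt P l), Type} {LogLink : ∀ (P : NFPoint) (l : ℕ) (T : Cor22.ThetaVolumeDatumAt P l), HT P l T → HT P l T → Type}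
    {IsFull : ∀ (P : NFPoint) (l : ℕ) (T : Cor22.ThetaVolumeDatumAt P l), ∀ {s t : HT P l T}, LogLink P l T s t → Prop}
    (lat : ∀ (P : NFPoint) (l : ℕ) (T : Cor22.ThetaVolumeDatumAt P l), LGPGaussianLogThetaLattice (LogLink P l T) (IsFull P l T))
    {Frd : ∀ (P : NFPoint) (l : ℕ) (T : Cor22.ThetaVolumeDatumAt P l), Type} {IsoF : ∀ (P : NFPoint) (l : ℕ) (T : Cor22.ThetaVolumeDatumAt P l), Frd P l T → Frd P l T → Type} {Ob : ∀ (P : NFPoint) (l : ℕ) (T : Cor22.ThetaVolumeDatumAt P l), Frd P l T → Type}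
    {realify : ∀ (P : NFPoint) (l : ℕ) (T : Cor22.ThetaVolumeDatumAt P l), Frd P l T → Frd P l T} {Strip : ∀ (P : NFPoint) (l : ℕ) (T : Cor22.ThetaVolumeDatumAt P l), Type} {IsoS : ∀ (P : NFPoint) (l : ℕ) (T : Cor22.ThetaVolumeDatumAt P l), Strip P l T → Strip P l T → Type}
    {Mv : ∀ (P : NFPoint) (l : ℕ) (T : Cor22.ThetaVolumeDatumAt P l), letI := T.instFieldF; letI := T.instNumberFieldF; letI := T.instAlgebraF; letI := T.instFieldK;
        letI := T.instNumberFieldK; letI := T.instAlgebraK; letI := T.instFieldFbar; letI := T.instAlgebraFbar;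
        letI := T.instAlgebraKFbar; letI := T.instIsElliptic;
      ∀ v : (thetaIndex (pilotDataOfK T.D T.K)).V, v ∈ (thetaIndex (pilotDataOfK T.D T.K)).Vbad → Type}
    [∀ P l T v h, Monoid (Mv P l T v h)]
    (sig : ∀ (P : NFPoint) (l : ℕ) (T : Cor22.ThetaVolumeDatumAt P l), letI := T.instFieldF; letI := T.instNumberFieldF; letI := T.instAlgebraF; letI := T.instFieldK;
        letI := T.instNumberFieldK; letI := T.instAlgebraK; letI := T.instFieldFbar; letI := T.instAlgebraFbar;
        letI := T.instAlgebraKFbar; letI := T.instIsElliptic;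
      GlobalLGPFrobenioidSignature (thetaIndex (pilotDataOfK T.D T.K)).lstar (thetaIndex (pilotDataOfK T.D T.K)).V (· ∈ (thetaIndex (pilotDataOfK T.D T.K)).Vbad) (Frd P l T) (IsoF P l T) (Ob P l T) (realify P l T)
        (Strip P l T) (IsoS P l T) (Mv P l T))
    (split : ∀ (P : NFPoint) (l : ℕ) (T : Cor22.ThetaVolumeDatumAt P l), SplittingMonoids (Mv P l T))
    {ObΔ : ∀ (P : NFPoint) (l : ℕ) (T : Cor22.ThetaVolumeDatumAt P l), Type} {N : ∀ (P : NFPoint) (l : ℕ) (T : Cor22.ThetaVolumeDatumAt P l), letI := T.instFieldF; letI := T.instNumberFieldF; letI := T.instAlgebraF; letI := T.instFieldK;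
        letI := T.instNumberFieldK; letI := T.instAlgebraK; letI := T.instFieldFbar; letI := T.instAlgebraFbar;
        letI := T.instAlgebraKFbar; letI := T.instIsElliptic;
      ∀ v : (thetaIndex (pilotDataOfK T.D T.K)).V, v ∈ (thetaIndex (pilotDataOfK T.D T.K)).Vbad → Type}
    [∀ P l T v h, Monoid (N P l T v h)] (qData : ∀ (P : NFPoint) (l : ℕ) (T : Cor22.ThetaVolumeDatumAt P l), QPilotData (ObΔ P l T) (N P l T))


include M archPk archSub Ψ act Mmod region n lat sig split qData in
/-- **`LedgerAtDatum T ⟹ T.Cor312NonarchOf` with (O″) owed ONLY at the bad primes `p ≢ 3 (mod 4)`** — abc-iut-rh2-L1's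
`ReachLedgerQ2.cor312NonarchOf_of_ledgerAtDatum_outerUnit` VERBATIM except that (O″) carries the extra antecedent `p % 4 ≠ 3`; at
`p ≡ 3 (mod 4)` the clause holds by `√−1 ∈ K` (`InitialThetaData.outerUnit_clause_of_mod_four_eq_three`). H⋆₂₇ is a HYPOTHESIS; no side
taken on [IUTchIII] Cor. 3.12. [cite: NeukirchANT1999, Ch. I §8, Ch. II (5.5)–(5.7)] [cite: Mochizuki2012, IUTchI Def. 3.1 (a),(b) p. 61,
Ex. 3.2 (iv) p. 71; IUTchIII Cor. 3.12 p. 173–174] [cite: DupuyHilado2025, §1 (1.1), §3.4, §3.9, §4.9] [claim: Mochizuki2012, status: disputed] -/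
theorem cor312NonarchOf_of_ledgerAtDatum_outerUnit_modFour {P : NFPoint} {l : ℕ} (T : Cor22.ThetaVolumeDatumAt P l)
    (huni : letI := T.instFieldF; letI := T.instNumberFieldF; letI := T.instAlgebraF; letI := T.instFieldK;
        letI := T.instNumberFieldK; letI := T.instAlgebraK; letI := T.instFieldFbar; letI := T.instAlgebraFbar;
        letI := T.instAlgebraKFbar; letI := T.instIsElliptic;
      ∀ (pp : Nat.Primes) (w x : (thetaIndex (pilotDataOfK T.D T.K)).Fibre (.inr pp)), haveI : Fact (pp : ℕ).Prime := ⟨pp.2⟩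
        placeOf (pilotDataOfK T.D T.K) pp.1 w ∈ (pilotDataOfK T.D T.K).S →
          (placeOf (pilotDataOfK T.D T.K) pp.1 x).asIdeal.ramificationIdx ℤ = (placeOf (pilotDataOfK T.D T.K) pp.1 w).asIdeal.ramificationIdx ℤ)
    (hO : letI := T.instFieldF; letI := T.instNumberFieldF; letI := T.instAlgebraF; letI := T.instFieldK;
        letI := T.instNumberFieldK; letI := T.instAlgebraK; letI := T.instFieldFbar; letI := T.instAlgebraFbar;
        letI := T.instAlgebraKFbar; letI := T.instIsElliptic;
      ∀ (pp : Nat.Primes) (w : (thetaIndex (pilotDataOfK T.D T.K)).Fibre (.inr pp)), haveI : Fact (pp : ℕ).Prime := ⟨pp.2⟩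
        placeOf (pilotDataOfK T.D T.K) pp.1 w ∈ (pilotDataOfK T.D T.K).S → (pp : ℕ) % 4 ≠ 3 →
          (∀ a : ℕ, (((placeOf (pilotDataOfK T.D T.K) pp.1 w).asIdeal.ramificationIdx ℤ : ℕ) : ℤ) ≠
              ((pp : ℕ) : ℤ) ^ a * (((pp : ℕ) : ℤ) - 1)) ∨
            ∀ x : (thetaIndex (pilotDataOfK T.D T.K)).Fibre (.inr pp),
              2 ≤ (placeOf (pilotDataOfK T.D T.K) pp.1 x).asIdeal.inertiaDeg ℤ ∨
                ∃ π : kOf (pilotDataOfK T.D T.K) pp.1 x,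
                  ‖π‖ = ((pp : ℕ) : ℝ) ^ (-(1 : ℝ) / ((placeOf (pilotDataOfK T.D T.K) pp.1 w).asIdeal.ramificationIdx ℤ : ℝ)) ∧
                    ‖1 + π ^ ((placeOf (pilotDataOfK T.D T.K) pp.1 w).asIdeal.ramificationIdx ℤ) /
                      ((pp : ℕ) : kOf (pilotDataOfK T.D T.K) pp.1 x)‖ = 1)
    (hL : LedgerAtDatum T) :
    T.Cor312NonarchOf := by
  letI := T.instFieldF; letI := T.instNumberFieldF; letI := T.instAlgebraF; letI := T.instFieldK
  letI := T.instNumberFieldK; letI := T.instAlgebraK; letI := T.instFieldFbar; letI := T.instAlgebraFbar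
  letI := T.instAlgebraKFbar; letI := T.instIsElliptic
  haveI hne : ∀ pp : Nat.Primes, Fact (pp : ℕ).Prime := fun pp => ⟨pp.2⟩
  refine cor312NonarchOf_of_ledgerAtDatum_outerUnit M archPk archSub Ψ act Mmod region n lat sig split qData T huni
    (fun pp w hw => ?_) hL
  by_cases h4 : (pp : ℕ) % 4 = 3
  · exact T.D.outerUnit_clause_of_mod_four_eq_three pp h4 ((placeOf (pilotDataOfK T.D T.K) pp.1 w).asIdeal.ramificationIdx ℤ)
  · exact hO pp w hw h4

include M archPk archSub Ψ act Mmod region n lat sig split qData in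
/-- **`K/ℚ` GALOIS rows: `LedgerAtDatum T` ∧ (O″ off `p ≡ 3 (mod 4)`) ⟹ `T.Cor312NonarchOf`** — (U) by `ramificationIdx_placeOf_eq_of_isGalois`.
[cite: NeukirchANT1999, Ch. I §9 (9.1), Ch. II (5.5)–(5.7)] [claim: Mochizuki2012, status: disputed] -/
theorem cor312NonarchOf_of_ledgerAtDatum_outerUnit_of_isGalois_modFour {P : NFPoint} {l : ℕ} (T : Cor22.ThetaVolumeDatumAt P l)
    (hgal : letI := T.instFieldF; letI := T.instNumberFieldF; letI := T.instAlgebraF; letI := T.instFieldK;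
        letI := T.instNumberFieldK; letI := T.instAlgebraK; letI := T.instFieldFbar; letI := T.instAlgebraFbar;
        letI := T.instAlgebraKFbar; letI := T.instIsElliptic; IsGalois ℚ T.K)
    (hO : letI := T.instFieldF; letI := T.instNumberFieldF; letI := T.instAlgebraF; letI := T.instFieldK;
        letI := T.instNumberFieldK; letI := T.instAlgebraK; letI := T.instFieldFbar; letI := T.instAlgebraFbar;
        letI := T.instAlgebraKFbar; letI := T.instIsElliptic;
      ∀ (pp : Nat.Primes) (w : (thetaIndex (pilotDataOfK T.D T.K)).Fibre (.inr pp)), haveI : Fact (pp : ℕ).Prime := ⟨pp.2⟩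
        placeOf (pilotDataOfK T.D T.K) pp.1 w ∈ (pilotDataOfK T.D T.K).S → (pp : ℕ) % 4 ≠ 3 →
          (∀ a : ℕ, (((placeOf (pilotDataOfK T.D T.K) pp.1 w).asIdeal.ramificationIdx ℤ : ℕ) : ℤ) ≠
              ((pp : ℕ) : ℤ) ^ a * (((pp : ℕ) : ℤ) - 1)) ∨
            ∀ x : (thetaIndex (pilotDataOfK T.D T.K)).Fibre (.inr pp),
              2 ≤ (placeOf (pilotDataOfK T.D T.K) pp.1 x).asIdeal.inertiaDeg ℤ ∨
                ∃ π : kOf (pilotDataOfK T.D T.K) pp.1 x,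
                  ‖π‖ = ((pp : ℕ) : ℝ) ^ (-(1 : ℝ) / ((placeOf (pilotDataOfK T.D T.K) pp.1 w).asIdeal.ramificationIdx ℤ : ℝ)) ∧
                    ‖1 + π ^ ((placeOf (pilotDataOfK T.D T.K) pp.1 w).asIdeal.ramificationIdx ℤ) /
                      ((pp : ℕ) : kOf (pilotDataOfK T.D T.K) pp.1 x)‖ = 1)
    (hL : LedgerAtDatum T) :
    T.Cor312NonarchOf := by
  letI := T.instFieldF; letI := T.instNumberFieldF; letI := T.instAlgebraF; letI := T.instFieldK
  letI := T.instNumberFieldK; letI := T.instAlgebraK; letI := T.instFieldFbar; letI := T.instAlgebraFbar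
  letI := T.instAlgebraKFbar; letI := T.instIsElliptic
  haveI := hgal
  exact cor312NonarchOf_of_ledgerAtDatum_outerUnit_modFour M archPk archSub Ψ act Mmod region n lat sig split qData T
    (fun pp w x _ => ramificationIdx_placeOf_eq_of_isGalois (pilotDataOfK T.D T.K) pp w x) hO hL

include M archPk archSub Ψ act Mmod region n lat sig split qData in
/-- **`K2Target27` from ONE structural hypothesis — every Σ₂₇ datum (antecedents of `K2Target27` VERBATIM) satisfies (U) at its bad primes and
(O″) at its bad primes `p ≢ 3 (mod 4)`.** Explicit 1. abc-iut-rh2-L1's `k2Target27_of_outerUnit` with the `p ≡ 3 (mod 4)` clauses discharged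
by `√−1 ∈ K`. The residual of row 27's certificate binder is thus exactly the Σ₂₇ data with a bad prime `p ≡ 1 (mod 4)` of cyclotomic index
(`l ∣ p − 1`) carrying a residue-degree-`1` place of cyclotomic type. [cite: NeukirchANT1999, Ch. I §8, Ch. II (5.5)–(5.7)]
[cite: Mochizuki2012, IUTchI Def. 3.1 (a),(b) p. 61] [claim: Mochizuki2012, status: disputed] -/
theorem k2Target27_of_outerUnit_modFour
    (hUO : ∀ (P : NFPoint), P ∈ UP → ∀ (l : ℕ), l.Prime → 5 ≤ l →
      Cor22.AdmitsCore P → Cor22.CondP2 P l → Cor22.CondP5 P l → Cor22.CondP6 P l →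
      (((l : ℝ) + 5) / 4 < (Cor22.dmod P : ℝ) ∨
        6 * l * (((l : ℝ) + 5) - 4 * Cor22.dmod P) / (((l : ℝ) + 4) * ((l : ℝ) - 3))
            * (P.logDiff + (1 - 1 / (l : ℝ)) * Cor22.logCondAvoid P {2, l})
          + 6 * l * ((l : ℝ) + 5) / (((l : ℝ) + 4) * ((l : ℝ) - 3)) * Real.log Real.pi < Cor22.logQAvoid P {2, l}) →
      ∀ (T : Cor22.ThetaVolumeDatumAt P l), letI := T.instFieldF; letI := T.instNumberFieldF; letI := T.instAlgebraF; letI := T.instFieldK;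
        letI := T.instNumberFieldK; letI := T.instAlgebraK; letI := T.instFieldFbar; letI := T.instAlgebraFbar;
        letI := T.instAlgebraKFbar; letI := T.instIsElliptic;
      ¬ (∃ (pp : Nat.Primes) (_ : 2 < (pp : ℕ)) (i : Fin (thetaIndex (pilotDataOfK T.D T.K)).lstar)
          (x₀ : (thetaIndex (pilotDataOfK T.D T.K)).Fibre (.inr pp)),
        haveI : Fact (pp : ℕ).Prime := ⟨pp.2⟩
        ((pp : ℕ) : ℝ) ^ ((((i : ℕ) : ℝ) + 2) * (4 + 2 * Real.logb (pp : ℕ) (Module.finrank ℚ T.K)) + 1) *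
          ‖(exists_realising_qIdeles_pilotDataOfK T.D).choose pp x₀‖ ^ (((i : ℕ) + 1) ^ 2 - 1) < 1) →
      (∀ (pp : Nat.Primes) (w x : (thetaIndex (pilotDataOfK T.D T.K)).Fibre (.inr pp)), haveI : Fact (pp : ℕ).Prime := ⟨pp.2⟩
        placeOf (pilotDataOfK T.D T.K) pp.1 w ∈ (pilotDataOfK T.D T.K).S →
          (placeOf (pilotDataOfK T.D T.K) pp.1 x).asIdeal.ramificationIdx ℤ = (placeOf (pilotDataOfK T.D T.K) pp.1 w).asIdeal.ramificationIdx ℤ) ∧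
        (∀ (pp : Nat.Primes) (w : (thetaIndex (pilotDataOfK T.D T.K)).Fibre (.inr pp)), haveI : Fact (pp : ℕ).Prime := ⟨pp.2⟩
        placeOf (pilotDataOfK T.D T.K) pp.1 w ∈ (pilotDataOfK T.D T.K).S → (pp : ℕ) % 4 ≠ 3 →
          (∀ a : ℕ, (((placeOf (pilotDataOfK T.D T.K) pp.1 w).asIdeal.ramificationIdx ℤ : ℕ) : ℤ) ≠
              ((pp : ℕ) : ℤ) ^ a * (((pp : ℕ) : ℤ) - 1)) ∨
            ∀ x : (thetaIndex (pilotDataOfK T.D T.K)).Fibre (.inr pp),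
              2 ≤ (placeOf (pilotDataOfK T.D T.K) pp.1 x).asIdeal.inertiaDeg ℤ ∨
                ∃ π : kOf (pilotDataOfK T.D T.K) pp.1 x,
                  ‖π‖ = ((pp : ℕ) : ℝ) ^ (-(1 : ℝ) / ((placeOf (pilotDataOfK T.D T.K) pp.1 w).asIdeal.ramificationIdx ℤ : ℝ)) ∧
                    ‖1 + π ^ ((placeOf (pilotDataOfK T.D T.K) pp.1 w).asIdeal.ramificationIdx ℤ) /
                      ((pp : ℕ) : kOf (pilotDataOfK T.D T.K) pp.1 x)‖ = 1)) :
    K2Target27 := by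
  intro P hP l hl h5 hc h2 h5' h6 hbad T hwin hL
  obtain ⟨huni, hO⟩ := hUO P hP l hl h5 hc h2 h5' h6 hbad T hwin
  exact cor312NonarchOf_of_ledgerAtDatum_outerUnit_modFour M archPk archSub Ψ act Mmod region n lat sig split qData T huni hO hL

include M archPk archSub Ψ act Mmod region n lat sig split qData in
/-- **`K2Target27` on the `K/ℚ`-GALOIS stratum with (O″) owed only off `p ≡ 3 (mod 4)`** — from ONE hypothesis: every Σ₂₇ datum has `K/ℚ`
Galois and (O″) at its bad primes `p ≢ 3 (mod 4)`. Explicit 1. [cite: NeukirchANT1999, Ch. I §8, §9 (9.1), Ch. II (5.5)–(5.7)]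
[claim: Mochizuki2012, status: disputed] -/
theorem k2Target27_of_isGalois_outerUnit_modFour
    (hGO : ∀ (P : NFPoint), P ∈ UP → ∀ (l : ℕ), l.Prime → 5 ≤ l →
      Cor22.AdmitsCore P → Cor22.CondP2 P l → Cor22.CondP5 P l → Cor22.CondP6 P l →
      (((l : ℝ) + 5) / 4 < (Cor22.dmod P : ℝ) ∨
        6 * l * (((l : ℝ) + 5) - 4 * Cor22.dmod P) / (((l : ℝ) + 4) * ((l : ℝ) - 3))
            * (P.logDiff + (1 - 1 / (l : ℝ)) * Cor22.logCondAvoid P {2, l})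
          + 6 * l * ((l : ℝ) + 5) / (((l : ℝ) + 4) * ((l : ℝ) - 3)) * Real.log Real.pi < Cor22.logQAvoid P {2, l}) →
      ∀ (T : Cor22.ThetaVolumeDatumAt P l), letI := T.instFieldF; letI := T.instNumberFieldF; letI := T.instAlgebraF; letI := T.instFieldK;
        letI := T.instNumberFieldK; letI := T.instAlgebraK; letI := T.instFieldFbar; letI := T.instAlgebraFbar;
        letI := T.instAlgebraKFbar; letI := T.instIsElliptic;
      ¬ (∃ (pp : Nat.Primes) (_ : 2 < (pp : ℕ)) (i : Fin (thetaIndex (pilotDataOfK T.D T.K)).lstar)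
          (x₀ : (thetaIndex (pilotDataOfK T.D T.K)).Fibre (.inr pp)),
        haveI : Fact (pp : ℕ).Prime := ⟨pp.2⟩
        ((pp : ℕ) : ℝ) ^ ((((i : ℕ) : ℝ) + 2) * (4 + 2 * Real.logb (pp : ℕ) (Module.finrank ℚ T.K)) + 1) *
          ‖(exists_realising_qIdeles_pilotDataOfK T.D).choose pp x₀‖ ^ (((i : ℕ) + 1) ^ 2 - 1) < 1) →
      IsGalois ℚ T.K ∧
        (∀ (pp : Nat.Primes) (w : (thetaIndex (pilotDataOfK T.D T.K)).Fibre (.inr pp)), haveI : Fact (pp : ℕ).Prime := ⟨pp.2⟩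
        placeOf (pilotDataOfK T.D T.K) pp.1 w ∈ (pilotDataOfK T.D T.K).S → (pp : ℕ) % 4 ≠ 3 →
          (∀ a : ℕ, (((placeOf (pilotDataOfK T.D T.K) pp.1 w).asIdeal.ramificationIdx ℤ : ℕ) : ℤ) ≠
              ((pp : ℕ) : ℤ) ^ a * (((pp : ℕ) : ℤ) - 1)) ∨
            ∀ x : (thetaIndex (pilotDataOfK T.D T.K)).Fibre (.inr pp),
              2 ≤ (placeOf (pilotDataOfK T.D T.K) pp.1 x).asIdeal.inertiaDeg ℤ ∨
                ∃ π : kOf (pilotDataOfK T.D T.K) pp.1 x,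
                  ‖π‖ = ((pp : ℕ) : ℝ) ^ (-(1 : ℝ) / ((placeOf (pilotDataOfK T.D T.K) pp.1 w).asIdeal.ramificationIdx ℤ : ℝ)) ∧
                    ‖1 + π ^ ((placeOf (pilotDataOfK T.D T.K) pp.1 w).asIdeal.ramificationIdx ℤ) /
                      ((pp : ℕ) : kOf (pilotDataOfK T.D T.K) pp.1 x)‖ = 1)) :
    K2Target27 := by
  intro P hP l hl h5 hc h2 h5' h6 hbad T hwin hL
  obtain ⟨hgal, hO⟩ := hGO P hP l hl h5 hc h2 h5' h6 hbad T hwin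
  exact cor312NonarchOf_of_ledgerAtDatum_outerUnit_of_isGalois_modFour M archPk archSub Ψ act Mmod region n lat sig split qData T hgal hO hL

end KFamily

end Summit.ABC.IUTFork.Repair.RH.TieDecider

end
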